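import Summits.HodgeConjecture.HodgeConjecture.Cruxes.BlochSeedDiscOne.LeggedFloor

/-!
# RuleDHull — the RULE-D HULL LAW of a shell (plan-lens-HodgeAV-extremal g25, AXIS-HEAVY-extremal-g25 §§1–2)

Token: line stmt-HodgeConjecture-18881 Cruxes/BlochSeedDiscOne/Lines/birth.lean 814a6a70c14e831a stub_rung_pad4_seedAt.

LETTER-MODEL BOOKKEEPING ONLY (`DepthBoundA4.Design`, RULE D verbatim from `LeggedFloor`); nothing here is a sheaf, a display
or a SEED, and nothing here is proved toward HC ∕ HC_CM ∕ HC_AV ∕ №4 ∕ 26512 ∕ 18881 ∕ H2.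

## What is proved (sorry-free; imports the data model + RULE D only; no `axiom` ∕ `instance` ∕ `unsafe` ∕ `native_decide`)

Put `ρ(ℓ) = 0` for the hub letter (`β = 0`), `1` for an axis letter (`x·y = 0`, `β ≠ 0`), `2` for an off-axis letter (the number
of null up-steps needed to reach the hub), and say the design lives INSIDE SHELL `K` at height `h` when every letter of every
supported cell has level `a ≥ h − K` (on the height-`h` alphabet: co-level `|x| + |y| ≤ K`).  For slots `{g, j} ⊔ {k, l} = Fin 4`:

* `hullN` : under `OnAlphabet h ∧ RuleD ∧ Disj ∧ shell K`, every supported N-cell `y` whose block `(g, j)` detects satisfies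
  `(h − a_g) + (h − a_j) + 1 + max (ρ_k) (ρ_l) ≤ 2K`  (co-level form: `c_g + c_j + 1 + max ρ(complement) ≤ 2K`, `hullN_colevel`).
* `hullP` : every supported P-cell `x` whose blocks `(g, j)` and `(k, l)` both detect satisfies
  `(h − a_g) + (h − a_j) + max (ρ_k) (ρ_l) ≤ 2K`.
* the mechanism (`rho_step`, `maxRho_lift`): a null up-step lowers `ρ` by at most one (an off-axis letter is never one null
  step below the hub: `x² + y² = (|x| + |y|)²` forces `x·y = 0`), and RULE D's two clauses chase each other strictly in the
  block level-sum (`LeggedFloor.levelSum_lt_of_supplies_ne`), so the demand `c_g + c_j + 1 + max ρ` of an N-cell is bounded by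
  the demand of a strictly deeper N-cell, until the complement is hub–hub and the shell bound `c_g + c_j ≤ 2K` ends the chase.
* consequences used by the search lane (`AXIS-HEAVY-extremal-g25.md` §1): `three_offaxis_N_excluded` — inside shell 3 no
  supported N-cell has three off-axis letters of co-level ≥ 2 in slots `g, j, k` (so a fully charged N-cell of a shell-3 room has
  at least two AXIS letters); `octagon_N_excluded` — inside shell 4 no supported N-cell has four off-axis letters of co-level ≥ 3
  (the OCTAGON room `o21⁴` of extremal g24 and every `F₁`-type cell need shell ≥ 5).

The converse («every cell satisfying the inequalities occurs in some Rule-D ∧ Disj support inside the shell») is NOT claimed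
here; it is verified exhaustively for `K ≤ 4` by the fixpoint computation of the memo and conjectured for `K ≥ 5`.
-/

set_option linter.dupNamespace false
set_option autoImplicit false

namespace Summit.HodgeConjecture.HodgeConjecture.Cruxes.BlochSeedDiscOne.RuleDHull

open DepthBoundA4 LeggedFloor

/-- `ρ` = number of null up-steps from the letter to the hub: `0` hub, `1` axis, `2` off-axis. -/
def rho (ℓ : Letter) : ℤ := if ℓ.x = 0 ∧ ℓ.y = 0 then 0 else if ℓ.x * ℓ.y = 0 then 1 else 2

theorem rho_nonneg (ℓ : Letter) : 0 ≤ rho ℓ := by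
  unfold rho; split_ifs <;> norm_num

theorem rho_le_two (ℓ : Letter) : rho ℓ ≤ 2 := by
  unfold rho; split_ifs <;> norm_num

theorem rho_eq_zero_of_hub {ℓ : Letter} (h0 : ℓ.x = 0 ∧ ℓ.y = 0) : rho ℓ = 0 := by
  unfold rho; rw [if_pos h0]

theorem one_le_rho_of_charged {ℓ : Letter} (h0 : ¬ (ℓ.x = 0 ∧ ℓ.y = 0)) : 1 ≤ rho ℓ := by
  unfold rho; rw [if_neg h0]; split_ifs <;> norm_num

theorem rho_le_one_of_axis {ℓ : Letter} (hax : ℓ.x * ℓ.y = 0) : rho ℓ ≤ 1 := by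
  unfold rho; split_ifs <;> norm_num

theorem rho_eq_two_of_offaxis {ℓ : Letter} (hoff : ℓ.x * ℓ.y ≠ 0) : rho ℓ = 2 := by
  unfold rho
  have h0 : ¬ (ℓ.x = 0 ∧ ℓ.y = 0) := fun h => hoff (by rw [h.1]; ring)
  rw [if_neg h0, if_neg hoff]

/-- An off-axis letter is never ONE null step below the hub: on the alphabet the step would have `x² + y² = (|x| + |y|)²`. -/
theorem axis_of_nullStep_hub {h : ℤ} {ℓ ℓ' : Letter} (hℓ : ℓ.OnAlphabet h) (hℓ' : ℓ'.OnAlphabet h)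
    (hs : NullStep ℓ ℓ') (h0 : ℓ'.x = 0 ∧ ℓ'.y = 0) : ℓ.x * ℓ.y = 0 := by
  have e1 := hℓ.1
  have e2 := hℓ'.1
  unfold Letter.height at e1 e2
  have hq := hs.2
  rw [h0.1, h0.2] at hq e2
  simp only [abs_zero, add_zero] at e2
  have hd : ℓ'.a - ℓ.a = |ℓ.x| + |ℓ.y| := by linarith
  rw [hd] at hq
  have hx2 : |ℓ.x| ^ 2 = ℓ.x ^ 2 := sq_abs ℓ.x
  have hy2 : |ℓ.y| ^ 2 = ℓ.y ^ 2 := sq_abs ℓ.y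
  have hprod : |ℓ.x| * |ℓ.y| = 0 := by nlinarith [abs_nonneg ℓ.x, abs_nonneg ℓ.y]
  have : |ℓ.x * ℓ.y| = 0 := by rw [abs_mul]; exact hprod
  exact abs_eq_zero.mp this

/-- A null up-step lowers `ρ` by at most one. -/
theorem rho_step {h : ℤ} {ℓ ℓ' : Letter} (hℓ : ℓ.OnAlphabet h) (hℓ' : ℓ'.OnAlphabet h) (hs : NullStep ℓ ℓ') :
    rho ℓ ≤ rho ℓ' + 1 := by
  by_cases h0 : ℓ'.x = 0 ∧ ℓ'.y = 0
  · have hax := axis_of_nullStep_hub hℓ hℓ' hs h0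
    have := rho_le_one_of_axis hax
    have := rho_nonneg ℓ'
    linarith
  · have := one_le_rho_of_charged h0
    have := rho_le_two ℓ
    linarith

theorem rho_eq_or_step {h : ℤ} {ℓ ℓ' : Letter} (hℓ : ℓ.OnAlphabet h) (hℓ' : ℓ'.OnAlphabet h)
    (hs : ℓ = ℓ' ∨ NullStep ℓ ℓ') : rho ℓ ≤ rho ℓ' + 1 := by
  rcases hs with e | hN
  · rw [e]; linarith
  · exact rho_step hℓ hℓ' hN

/-- `max ρ` over the two slots `k, l`. -/
def maxRho (c : Cell) (k l : Fin 4) : ℤ := max (rho (c k)) (rho (c l))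

theorem maxRho_nonneg (c : Cell) (k l : Fin 4) : 0 ≤ maxRho c k l :=
  le_trans (rho_nonneg (c k)) (le_max_left _ _)

theorem maxRho_le_two (c : Cell) (k l : Fin 4) : maxRho c k l ≤ 2 :=
  max_le (rho_le_two _) (rho_le_two _)

theorem maxRho_comm (c : Cell) (k l : Fin 4) : maxRho c k l = maxRho c l k := max_comm _ _

theorem maxRho_eq_zero_of_hubs {c : Cell} {k l : Fin 4}
    (hb : (c k).x = 0 ∧ (c k).y = 0 ∧ (c l).x = 0 ∧ (c l).y = 0) : maxRho c k l = 0 := by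
  unfold maxRho
  rw [rho_eq_zero_of_hub ⟨hb.1, hb.2.1⟩, rho_eq_zero_of_hub ⟨hb.2.2.1, hb.2.2.2⟩, max_self]

theorem maxRho_congr {c c' : Cell} {k l : Fin 4} (hk : c k = c' k) (hl : c l = c' l) :
    maxRho c k l = maxRho c' k l := by
  unfold maxRho; rw [hk, hl]

/-- LIFT LEMMA: a supplier pair on the block `(k, l)` (`x` below, `y` above) has `max ρ(x) ≤ max ρ(y) + 1` on that block. -/
theorem maxRho_lift {h : ℤ} {x y : Cell} {k l : Fin 4} (hxA : ∀ f : Fin 4, (x f).OnAlphabet h)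
    (hyA : ∀ f : Fin 4, (y f).OnAlphabet h) (hs : Supplies x y k l) : maxRho x k l ≤ maxRho y k l + 1 := by
  unfold maxRho
  have hk := rho_eq_or_step (hxA k) (hyA k) hs.2.1
  have hl := rho_eq_or_step (hxA l) (hyA l) hs.2.2
  have m1 := le_max_left (rho (y k)) (rho (y l))
  have m2 := le_max_right (rho (y k)) (rho (y l))
  exact max_le (by linarith) (by linarith)

/-- INSIDE SHELL `K` at height `h`: every letter of every supported cell has level `≥ h − K`. -/
def InShell (h K : ℤ) (D : Design) : Prop := ∀ c ∈ D.suppN ++ D.suppP, ∀ f : Fin 4, h - K ≤ (c f).a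

theorem colevel_eq_of_onAlphabet {h : ℤ} {ℓ : Letter} (hℓ : ℓ.OnAlphabet h) : ℓ.colevel = h - ℓ.a := by
  have e := hℓ.1
  unfold Letter.height at e
  unfold Letter.colevel
  linarith

/-- On the alphabet, «inside shell `K`» is «every co-level `≤ K`». -/
theorem inShell_iff_colevel (h K : ℤ) (D : Design) (hD : D.OnAlphabet h) :
    InShell h K D ↔ ∀ c ∈ D.suppN ++ D.suppP, ∀ f : Fin 4, (c f).colevel ≤ K := by
  constructor
  · intro hS c hc f
    rw [colevel_eq_of_onAlphabet (hD c hc f)]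
    have := hS c hc f
    linarith
  · intro hS c hc f
    have e := colevel_eq_of_onAlphabet (hD c hc f)
    have := hS c hc f
    linarith

/-- A strict supplier pair below an alphabet cell has a LOW leg on the block, so the block still detects one cell down. -/
theorem lowPair_of_supplies_ne {h : ℤ} {x y : Cell} {g j : Fin 4} (hyA : ∀ f : Fin 4, (y f).OnAlphabet h)
    (hs : Supplies x y g j) (hne : x ≠ y) : LowPair h x g j := by
  have hlt := levelSum_lt_of_supplies_ne hs hne
  have a1 := level_le_of_onAlphabet (hyA g)
  have a2 := level_le_of_onAlphabet (hyA j)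
  by_contra hcon
  have hg : h ≤ (x g).a := le_of_not_gt fun hlt' => hcon (Or.inl hlt')
  have hj : h ≤ (x j).a := le_of_not_gt fun hlt' => hcon (Or.inr hlt')
  linarith

/-- THE HULL LAW, N side (ordered slots `g < j`, `k < l`, `{g,j} ∩ {k,l} = ∅`). -/
theorem hullN (h K : ℤ) (D : Design) (hD : D.OnAlphabet h) (hr : RuleD D) (hdis : Disj D) (hK : InShell h K D)
    (g j k l : Fin 4) (hgj : g < j) (hkl : k < l) (h1 : g ≠ k) (h2 : g ≠ l) (h3 : j ≠ k) (h4 : j ≠ l) :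
    ∀ y ∈ D.suppN, Detects y g j → (h - (y g).a) + (h - (y j).a) + 1 + maxRho y k l ≤ 2 * K := by
  suffices key : ∀ n : ℕ, ∀ y ∈ D.suppN, Detects y g j →
      ((y g).a + (y j).a) - 2 * (h - K) < (n : ℤ) → (h - (y g).a) + (h - (y j).a) + 1 + maxRho y k l ≤ 2 * K by
    intro y hy hdet
    refine key ((((y g).a + (y j).a) - 2 * (h - K)).toNat + 1) y hy hdet ?_
    have := Int.self_le_toNat (((y g).a + (y j).a) - 2 * (h - K))
    push_cast
    linarith
  intro n
  induction n with
  | zero =>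
    intro y hy _ hlt
    have a1 := hK y (mem_supp_of_memN D hy) g
    have a2 := hK y (mem_supp_of_memN D hy) j
    push_cast at hlt
    linarith
  | succ n ih =>
    intro y hy hdet hlt
    have hyA : ∀ f : Fin 4, (y f).OnAlphabet h := hD y (mem_supp_of_memN D hy)
    -- RULE D, N side: a supplier `x ∈ suppP` one null step down on the block `(g, j)`
    obtain ⟨x, hx, hs⟩ := hr.1 y hy g j hgj hdet
    have hxA : ∀ f : Fin 4, (x f).OnAlphabet h := hD x (mem_supp_of_memP D hx)
    have hne : x ≠ y := fun heq => hdis x (heq ▸ hy) hx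
    have hstrict := levelSum_lt_of_supplies_ne hs hne
    have hxk : x k = y k := hs.1 k h1.symm h3.symm
    have hxl : x l = y l := hs.1 l h2.symm h4.symm
    have sxg := hK x (mem_supp_of_memP D hx) g
    have sxj := hK x (mem_supp_of_memP D hx) j
    by_cases hb : (y k).x = 0 ∧ (y k).y = 0 ∧ (y l).x = 0 ∧ (y l).y = 0
    · -- complement hub–hub: the shell bound on the supplier ends the chase
      rw [maxRho_eq_zero_of_hubs hb]
      push_cast at hlt
      linarith
    · -- complement charged somewhere: the block `(k, l)` of `x` detects; RULE D, P side lifts it to `y₂ ∈ suppN`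
      have hdetx : Detects x k l := by
        intro hcon
        rw [hxk, hxl] at hcon
        exact hb ⟨hcon.1, hcon.2.1, hcon.2.2.1, hcon.2.2.2.1⟩
      obtain ⟨y₂, hy₂, hs₂⟩ := hr.2 x hx k l hkl hdetx
      have hy₂A : ∀ f : Fin 4, (y₂ f).OnAlphabet h := hD y₂ (mem_supp_of_memN D hy₂)
      have hy₂g : y₂ g = x g := (hs₂.1 g h1 h2).symm
      have hy₂j : y₂ j = x j := (hs₂.1 j h3 h4).symm
      have hlift : maxRho x k l ≤ maxRho y₂ k l + 1 := maxRho_lift hxA hy₂A hs₂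
      have hMy : maxRho y k l = maxRho x k l := (maxRho_congr hxk hxl).symm
      -- the block `(g, j)` of `y₂` (= that of `x`) still detects
      have hlow : LowPair h x g j := lowPair_of_supplies_ne hyA hs hne
      have hlow₂ : LowPair h y₂ g j := by
        rcases hlow with a | b
        · left; rw [hy₂g]; exact a
        · right; rw [hy₂j]; exact b
      have hdet₂ : Detects y₂ g j := detects_of_lowPair hy₂A hlow₂
      have hih := ih y₂ hy₂ hdet₂ (by rw [hy₂g, hy₂j]; push_cast at hlt ⊢; linarith)
      rw [hy₂g, hy₂j] at hih
      rw [hMy]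
      linarith

/-- THE HULL LAW, P side: a supported P-cell whose blocks `(g, j)` and `(k, l)` both detect. -/
theorem hullP (h K : ℤ) (D : Design) (hD : D.OnAlphabet h) (hr : RuleD D) (hdis : Disj D) (hK : InShell h K D)
    (g j k l : Fin 4) (hgj : g < j) (hkl : k < l) (h1 : g ≠ k) (h2 : g ≠ l) (h3 : j ≠ k) (h4 : j ≠ l) :
    ∀ x ∈ D.suppP, Detects x g j → Detects x k l → (h - (x g).a) + (h - (x j).a) + maxRho x k l ≤ 2 * K := by
  intro x hx hdet hdet'
  have hxA : ∀ f : Fin 4, (x f).OnAlphabet h := hD x (mem_supp_of_memP D hx)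
  obtain ⟨y₂, hy₂, hs₂⟩ := hr.2 x hx k l hkl hdet'
  have hy₂A : ∀ f : Fin 4, (y₂ f).OnAlphabet h := hD y₂ (mem_supp_of_memN D hy₂)
  have hy₂g : y₂ g = x g := (hs₂.1 g h1 h2).symm
  have hy₂j : y₂ j = x j := (hs₂.1 j h3 h4).symm
  have hlift : maxRho x k l ≤ maxRho y₂ k l + 1 := maxRho_lift hxA hy₂A hs₂
  have hdet₂ : Detects y₂ g j := by
    intro hcon
    rw [hy₂g, hy₂j] at hcon
    exact hdet hcon
  have hN := hullN h K D hD hr hdis hK g j k l hgj hkl h1 h2 h3 h4 y₂ hy₂ hdet₂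
  rw [hy₂g, hy₂j] at hN
  linarith

/-- Co-level form of `hullN` (what the memo tables use): `c_g + c_j + 1 + max ρ(k, l) ≤ 2K`. -/
theorem hullN_colevel (h K : ℤ) (D : Design) (hD : D.OnAlphabet h) (hr : RuleD D) (hdis : Disj D) (hK : InShell h K D)
    (g j k l : Fin 4) (hgj : g < j) (hkl : k < l) (h1 : g ≠ k) (h2 : g ≠ l) (h3 : j ≠ k) (h4 : j ≠ l) :
    ∀ y ∈ D.suppN, Detects y g j → (y g).colevel + (y j).colevel + 1 + maxRho y k l ≤ 2 * K := by
  intro y hy hdet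
  have hyA : ∀ f : Fin 4, (y f).OnAlphabet h := hD y (mem_supp_of_memN D hy)
  rw [colevel_eq_of_onAlphabet (hyA g), colevel_eq_of_onAlphabet (hyA j)]
  exact hullN h K D hD hr hdis hK g j k l hgj hkl h1 h2 h3 h4 y hy hdet

/-- Co-level form of `hullP`: `c_g + c_j + max ρ(k, l) ≤ 2K`. -/
theorem hullP_colevel (h K : ℤ) (D : Design) (hD : D.OnAlphabet h) (hr : RuleD D) (hdis : Disj D) (hK : InShell h K D)
    (g j k l : Fin 4) (hgj : g < j) (hkl : k < l) (h1 : g ≠ k) (h2 : g ≠ l) (h3 : j ≠ k) (h4 : j ≠ l) :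
    ∀ x ∈ D.suppP, Detects x g j → Detects x k l → (x g).colevel + (x j).colevel + maxRho x k l ≤ 2 * K := by
  intro x hx hdet hdet'
  have hxA : ∀ f : Fin 4, (x f).OnAlphabet h := hD x (mem_supp_of_memP D hx)
  rw [colevel_eq_of_onAlphabet (hxA g), colevel_eq_of_onAlphabet (hxA j)]
  exact hullP h K D hD hr hdis hK g j k l hgj hkl h1 h2 h3 h4 x hx hdet hdet'

/-! ## Consequences for the search lane -/

/-- An off-axis letter detects any block it sits in. -/
theorem detects_of_offaxis_left {c : Cell} {g j : Fin 4} (hoff : (c g).x * (c g).y ≠ 0) : Detects c g j := by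
  intro hcon
  exact hoff (by rw [hcon.1]; ring)

/-- SHELL 3: no supported N-cell has slots `0, 1` of co-level `≥ 2` with slot `0` off-axis and slot `2` off-axis (so — using the
symmetric instances of `hullN` for the other slot patterns — no supported N-cell of a shell-3 room has three off-axis letters:
a fully charged one has at least two AXIS letters).  (Block `(0,1)`: `2 + 2 + 1 + ρ₂ = 7 > 6`.) -/
theorem three_offaxis_N_excluded (h : ℤ) (D : Design) (hD : D.OnAlphabet h) (hr : RuleD D) (hdis : Disj D)
    (hK : InShell h 3 D) (y : Cell) (hy : y ∈ D.suppN)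
    (h0 : (y 0).x * (y 0).y ≠ 0) (h2 : (y 2).x * (y 2).y ≠ 0)
    (c0 : 2 ≤ (y 0).colevel) (c1 : 2 ≤ (y 1).colevel) : False := by
  have hN := hullN_colevel h 3 D hD hr hdis hK 0 1 2 3 (by decide) (by decide) (by decide) (by decide) (by decide)
    (by decide) y hy (detects_of_offaxis_left h0)
  have hρ : rho (y 2) = 2 := rho_eq_two_of_offaxis h2
  have hm : rho (y 2) ≤ maxRho y 2 3 := le_max_left _ _
  linarith

/-- SHELL 4: no supported N-cell has slots `0, 1` of co-level `≥ 3` with slots `0` and `2` off-axis — in particular no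
supported N-cell has four off-axis letters of co-level `3`: the OCTAGON room `o21⁴` (extremal g24) and the `F₁` cells need
shell `≥ 5`.  (Block `(0,1)`: `3 + 3 + 1 + 2 = 9 > 8`.) -/
theorem octagon_N_excluded (h : ℤ) (D : Design) (hD : D.OnAlphabet h) (hr : RuleD D) (hdis : Disj D)
    (hK : InShell h 4 D) (y : Cell) (hy : y ∈ D.suppN)
    (h0 : (y 0).x * (y 0).y ≠ 0) (h2 : (y 2).x * (y 2).y ≠ 0)
    (c0 : 3 ≤ (y 0).colevel) (c1 : 3 ≤ (y 1).colevel) : False := by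
  have hN := hullN_colevel h 4 D hD hr hdis hK 0 1 2 3 (by decide) (by decide) (by decide) (by decide) (by decide)
    (by decide) y hy (detects_of_offaxis_left h0)
  have hρ : rho (y 2) = 2 := rho_eq_two_of_offaxis h2
  have hm : rho (y 2) ≤ maxRho y 2 3 := le_max_left _ _
  linarith

/-- SHELL `K`, general depth cap for a detecting block of an N-cell next to an off-axis letter: `c_g + c_j ≤ 2K − 3`. -/
theorem blockDepth_N_le (h K : ℤ) (D : Design) (hD : D.OnAlphabet h) (hr : RuleD D) (hdis : Disj D) (hK : InShell h K D)
    (g j k l : Fin 4) (hgj : g < j) (hkl : k < l) (h1 : g ≠ k) (h2 : g ≠ l) (h3 : j ≠ k) (h4 : j ≠ l)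
    (y : Cell) (hy : y ∈ D.suppN) (hdet : Detects y g j) (hoff : (y k).x * (y k).y ≠ 0) :
    (y g).colevel + (y j).colevel ≤ 2 * K - 3 := by
  have hN := hullN_colevel h K D hD hr hdis hK g j k l hgj hkl h1 h2 h3 h4 y hy hdet
  have hρ : rho (y k) = 2 := rho_eq_two_of_offaxis hoff
  have hm : rho (y k) ≤ maxRho y k l := le_max_left _ _
  linarith

/-- Sanity: `ρ` on the shell-3 letters of height 14. -/
example : rho ⟨14, 0, 0⟩ = 0 ∧ rho ⟨13, 1, 0⟩ = 1 ∧ rho ⟨12, 0, -2⟩ = 1 ∧ rho ⟨12, 1, -1⟩ = 2 ∧ rho ⟨11, 2, 1⟩ = 2 := by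
  decide

end Summit.HodgeConjecture.HodgeConjecture.Cruxes.BlochSeedDiscOne.RuleDHull
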